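import Summits.NavierStokesRegularity.NavierStokesRegularity.Theorems.FilamentSkeletonRssDefectColumnGateDefsR
import Summits.NavierStokesRegularity.NavierStokesRegularity.Theorems.FilamentSkeletonRssDefectColumnGateClosingIVTR
import Summits.NavierStokesRegularity.NavierStokesRegularity.Theorems.FilamentSkeletonRssDefectColumnGateContinuity
import HarnessLib.Audit

/-!
# Line `defect_column_gate_1AR` for the crux `FilamentSkeletonRss.TransverseReduction1AR` (stmt-NavierStokesRegularity-23611) — skeleton v6a (DIRECT, S0-FREE)

**LEAD EDIT (ns-filament-21221-p1 g12, LEAD of 23611, 2026-08-28) — the DIRECT 1AR skeleton asked by tenure g26's VET («(R-c) clock = the S0-FREE re-registration»)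
and critic idea-crit-7's (R-e) test («stubs take `Clauses1R` with its rate conjunct as a hypothesis and never quantify a rate row over all skeletons;
`TransverseReduction1AR_of` does not factor through `TransverseReduction1AL` / `…_imp_1AR`»).**  It supersedes the transitional v5R (8eee0463a08c523f).
Vocabulary: `Theorems/FilamentSkeletonRssDefectColumnGateDefsR.lean` (p674161): `Clauses1R` (13-R tail verbatim from the route decl), `CutForm1AR`,
`transverseReduction1AR_iff := Iff.rfl`, `DefectFamily1AR`, `DefectGate1AR`, `GateAssemblyLoc1AR := WaistColumnGateLoc1A → DefectGate1AR`, `DefectClosing1AR`,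
`ClosingIVT1AR`; S3a ported (`Theorems/…ClosingIVTR.lean`, `stub_closingIVT1AR`), S3b clause-free (p646054).

WHAT CHANGED w.r.t. v5/v5R (stub names — say so, tenure g24 rule): S0 `stub_rateSelection1AL` DELETED (its content is conjunct 16 of `Clauses1R`, a hypothesis of every
statement; LEAD R1 → A1R); S1 is now `stub_defectFamily1AR : DefectFamily1AR` (the former `stub_familyDressing1AL` without the `RateSelection` antecedent); S2a-loc
`stub_waistColumnGateLoc1A : WaistColumnGateLoc1A` UNCHANGED (same name and text, clause-free); S2b-loc is now `stub_gateAssemblyLoc1AR : GateAssemblyLoc1AR`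
(= `WaistColumnGateLoc1A → DefectGate1AR`; FLAGGED MISSTATED by the LEAD's R4 — waist-accretion cokernel, memo `Lines/defect_column_gate_1AL_accretion.md`; the
consequent's gate spec is the v5 `DefectGateSpec1AG`, kept verbatim pending the (δ) MODEL word of dss_117; NOT a proof target until then); S3 PROVED.  Three sorries.
Composition: `TransverseReduction1AR_of := transverseReduction1AR_iff.mpr (lineGlue1AR stub_defectFamily1AR (stub_gateAssemblyLoc1AR stub_waistColumnGateLoc1A)
defectClosing1AR_of_stubs)` — DIRECT, the crux BY NAME.  Briefs: `Lines/defect_column_gate_1AL_briefs.md` v6.1 read with L → R and S0 struck.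

HONEST FRAMING.  Bookkeeping for a HYPOTHETICAL filament-type rotating-self-similar blow-up route (`route-NavierStokesRegularity-FilamentSkeletonRss`, refutation side).
Nothing in this file moves Navier–Stokes regularity.  MODEL rung, negative side.  `lean check`: rc 0, sorries = 3 (only `stub_*`).
-/

set_option linter.dupNamespace false

noncomputable section

namespace Summit.NavierStokesRegularity.NavierStokesRegularity.Cruxes.TransverseReduction1AR.DefectColumnGate

open scoped BigOperators Topology Manifold Classical MeasureTheory ProbabilityTheory Matrix InnerProductSpace ComplexConjugate ContinuousMap ENNReal ContDiff
open Filter Set Function TopologicalSpace MeasureTheory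
open Literature.NS
open Literature.Analysis.FluidPDE
open Summit.NavierStokesRegularity.NavierStokesRegularity.Theses.FilamentSkeletonRss
open Summit.NavierStokesRegularity.NavierStokesRegularity.Theorems.KelvinGate (lerayOp lerayLin XBound YBound LocClose)
open Summit.NavierStokesRegularity.NavierStokesRegularity.Theorems.DefectColumnGate

/-! ## Registered stubs (v6a) and the kernel-checked composition -/

/-- **Stub S1** (`DefectFamily1AR`) — matched asymptotics with order-by-order rate corrections (the rate row is clause 13-R of the hypothesis block),
re-wound ends, forced window. -/
theorem stub_defectFamily1AR : DefectFamily1AR := by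
  sorry

/-- **Stub S2a-loc** (`WaistColumnGateLoc1A`) — one explicit linear operator, sectionally localised; UNCHANGED from v4/v5 (clause-free; ALIVE; bricks through
p673976). -/
theorem stub_waistColumnGateLoc1A : WaistColumnGateLoc1A := by
  sorry

/-- **Stub S2b-loc** (`GateAssemblyLoc1AR` = `WaistColumnGateLoc1A → DefectGate1AR`) — patching; the rate row is READ from clause 13-R.  FLAGGED MISSTATED by the
LEAD's R4 (waist-accretion cokernel): NOT a proof target until the (δ) MODEL word; a two-scale re-cut (γ) would replace `DefectGateSpec1AG` in its consequent. -/
theorem stub_gateAssemblyLoc1AR : GateAssemblyLoc1AR := by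
  sorry

/-- **Stub S3a** (`ClosingIVT1AR`) — PROVED for the R-crux (Theorems/FilamentSkeletonRssDefectColumnGateClosingIVTR.lean; port of p665712 / p646026). -/
theorem stub_closingIVT1AR : ClosingIVT1AR :=
  Summit.NavierStokesRegularity.NavierStokesRegularity.Theorems.DefectColumnGate.stub_closingIVT1AR

/-- **Stub S3b** (`DefectContinuity1AG`) — PROVED by the lead (Theorems/FilamentSkeletonRssDefectColumnGateContinuity.lean, p646054), clause-free. -/
theorem stub_defectContinuity1AG : DefectContinuity1AG :=
  Summit.NavierStokesRegularity.NavierStokesRegularity.Theorems.DefectColumnGate.stub_defectContinuity1AG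

/-- **S3 `DefectClosing1AR` — a THEOREM** (both halves proved). -/
theorem defectClosing1AR_of_stubs : DefectClosing1AR :=
  stub_closingIVT1AR stub_defectContinuity1AG

/-- **Glue (pure logic + the LANDED smoothing ladder, no sorry)** — verbatim `lineGlue1AL` over the R vocabulary. -/
theorem lineGlue1AR (h1 : DefectFamily1AR) (h2 : DefectGate1AR) (h3 : DefectClosing1AR) : CutForm1AR := by
  intro N δ ρ K Λ a b cnd η Rw Rb cg θ₀ KA hN hδ hρ ha hη hRw hRb hcg hθ₀
  obtain ⟨Cs, hS1⟩ := h1 N δ ρ K Λ a b cnd η Rw Rb cg θ₀ KA hN hδ hρ ha hη hRw hRb hcg hθ₀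
  obtain ⟨κ, C₂, q₀, k₀, hS2⟩ := h2 N δ ρ K Λ a b cnd η Rw Rb cg θ₀ KA hN hδ hρ ha hη hRw hRb hcg hθ₀ Cs
  obtain ⟨q₁, hq, k, hk₀, hk, hS3⟩ := h3 N δ ρ K Λ a b cnd η Rw Rb cg θ₀ KA hN hδ hρ ha hη hRw hRb hcg hθ₀ Cs κ C₂ q₀ k₀
  obtain ⟨Cr, Γa, hS1'⟩ := hS1 q₁ k
  obtain ⟨Γb, hS2'⟩ := hS2 q₁ hq k hk₀ hk Cr
  obtain ⟨Γc, hS3'⟩ := hS3 Cr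
  refine ⟨max Γa (max Γb Γc), ?_⟩
  intro Γ hΓ γ α X w c m n Aa u v A T hu hv hA hT hcl
  have hΓa : Γa ≤ Γ := le_trans (le_max_left _ _) hΓ
  have hΓb : Γb ≤ Γ := le_trans (le_trans (le_max_left _ _) (le_max_right _ _)) hΓ
  have hΓc : Γc ≤ Γ := le_trans (le_trans (le_max_right _ _) (le_max_right _ _)) hΓ
  obtain ⟨α0, β₀, U0, P0, Z, g, r, hfam⟩ := hS1' Γ hΓa γ α X w c m n Aa u v A T hu hv hA hT hcl
  obtain ⟨𝓚, 𝓠, 𝓫, hgate⟩ := hS2' Γ hΓb γ α X w c m n Aa u v A T hu hv hA hT hcl α0 β₀ U0 P0 Z g r hfam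
  obtain ⟨α₁, C₀, M, U, P, hU⟩ := hS3' Γ hΓc γ α X w c m n Aa u v A T hu hv hA hT hcl α0 β₀ U0 P0 Z g r hfam 𝓚 𝓠 𝓫 hgate
  obtain ⟨hα₁, hne, hU2, hP1, hdiv, heq, hdec, hPM, hwin⟩ := hU
  have hF : ContDiff ℝ ∞ (fun _ : EuclideanSpace ℝ (Fin 3) => (0 : EuclideanSpace ℝ (Fin 3))) := contDiff_const
  have hUs : ContDiff ℝ ∞ U :=
    Theorems.KelvinGate.Smoothing.contDiff_velocity_infty (F := fun _ => 0) hU2 hdiv hP1 hF heq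
  have hPs : ContDiff ℝ ∞ P :=
    Theorems.KelvinGate.Smoothing.contDiff_pressure_infty (F := fun _ => 0) hU2 hdiv hP1 hF heq
  exact ⟨α₁, C₀, M, U, P, hα₁, hne, hUs, hPs, hdiv, heq, hdec, hPM, hwin⟩

/-- **The skeleton (A12 shape, DIRECT): the crux BY NAME from the registered stubs** — no `RateSelection`, no detour through `TransverseReduction1AL`. -/
theorem TransverseReduction1AR_of : TransverseReduction1AR :=
  transverseReduction1AR_iff.mpr
    (lineGlue1AR stub_defectFamily1AR (stub_gateAssemblyLoc1AR stub_waistColumnGateLoc1A) defectClosing1AR_of_stubs)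

end Summit.NavierStokesRegularity.NavierStokesRegularity.Cruxes.TransverseReduction1AR.DefectColumnGate

end
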